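import Summits.Ventures.AbcShadow.SH04.Kraus67

/-!
# Venture AbcShadow — SH-04 `(29, 11)`: `KrausAux67` DECIDED IN THE KERNEL, and the reduction of a datum to the 𝔽₆₇ family

HONEST FRAMING. A kernel-computation file of the work-bound cell `abc-shadow` (typer seat `abc-shadow-typ-1`, lineage g6; KEY
9194c00c07baefe5; crit-1 C4/C6). NOTHING here is a theorem about the Diophantine equation beyond finite arithmetic modulo 67; no claim on
abc or on any summit; no side on IUT. CONTENTS (all proofs are `decide` evaluated by the KERNEL — no `native_decide`, no compiler trust —
plus elementary modular arithmetic):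
* `krausAux67 : KrausAux67` — for all `s ∈ [0,67)`, `t, u ∈ μ₆` with `s³ ≡ t + u (mod 67)`, the trace `67 + 1 − #E(𝔽₆₇)` of
  `Y² + 3s·XY + t·Y = X³` (LITERAL point count, `bvyCurveCount`) lies in `T₆₇ = {−16, −10, 5, 8, 11}` (36 curves; H6 of the critic's list).
* `pow_eleven_mod67_mem` — `m¹¹ mod 67 ∈ μ₆ = {1, 29, 30, 37, 38, 66}` for every integer `m` prime to 67; `pow29_mod67_mem` — `29^j mod 67
  ∈ {1, 29, 37} ⊂ μ₆` (`29³ = 24389 = 364·67 + 1`); closure of `μ₆` under products.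
* `freyTraceAt67_mem` — THE REDUCTION: for `A·B = 29^e` and `A a¹¹ + B b¹¹ = c³` with `67 ∤ a`, `67 ∤ b`, the Frey trace
  `freyTraceAt 67 (A, B, 1, 11, a, b, c)` (= `a₆₇` of `Y² + 3c·XY + B b¹¹·Y = X³`) lies in `T₆₇` — because `(s, t, u) =
  (c, B b¹¹, A a¹¹) mod 67` is a member of the family of `KrausAux67`.
Words: DECIDED-IN-KERNEL finite facts (H6); adjacent (signature (n,n,3)), NOT abc; AI-typed.
-/

namespace Summit.Ventures.AbcShadow

open Summit.Ventures.AbcSig (FreyDatum)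

/-! ## The finite facts modulo 67 (kernel `decide`) -/

/-- **H6, decided in the kernel: `KrausAux67`.** Every curve of the reduced Frey family at `67` has trace in `T₆₇ = {−16, −10, 5, 8, 11}`
(`decide`, kernel evaluation of 36 literal point counts over `𝔽₆₇²`). [cite: Kraus1998, §1 (the auxiliary-prime test, here q = 67 = 6·11 + 1)] -/
theorem krausAux67 : KrausAux67 := by
  unfold KrausAux67
  decide +kernel

/-- The eleventh powers of the nonzero residues mod 67 are exactly drawn from `μ₆` (kernel check over `r ∈ [1, 67)`). [folklore] -/
theorem pow_eleven_mod67_mem_nat : ∀ r : ℕ, r < 67 → r ≠ 0 → ((r : ℤ) ^ 11) % 67 ∈ mu6Mod67 := by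
  decide +kernel

/-- `μ₆` is closed under multiplication mod 67. [folklore] -/
theorem mu6Mod67_mul_mem : ∀ x ∈ mu6Mod67, ∀ y ∈ mu6Mod67, (x * y) % 67 ∈ mu6Mod67 := by
  decide

/-- One step of `29^j mod 67`: `{1, 29, 37}·29 ⊆ {1, 29, 37}` (`29² ≡ 37`, `29·37 ≡ 1`). [folklore] -/
theorem pow29_step : ∀ x ∈ ([1, 29, 37] : List ℤ), (x * 29) % 67 ∈ ([1, 29, 37] : List ℤ) := by
  decide

/-- `{1, 29, 37} ⊆ μ₆`. [folklore] -/
theorem pow29_residues_subset : ∀ x ∈ ([1, 29, 37] : List ℤ), x ∈ mu6Mod67 := by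
  decide

/-- `T₆₇ ⊆` the refined allowed list at 67. [folklore] -/
theorem krausTraces67_subset : ∀ t ∈ krausTraces67, t ∈ krausAllowed29 67 := by
  decide

/-! ## Elementary consequences -/

/-- `m¹¹ mod 67 ∈ μ₆` for every integer `m` not divisible by 67. [folklore] -/
theorem pow_eleven_mod67_mem (m : ℤ) (hm : ¬ (67 : ℤ) ∣ m) : (m ^ 11) % 67 ∈ mu6Mod67 := by
  have h0 : 0 ≤ m % 67 := Int.emod_nonneg m (by norm_num)
  have h1 : m % 67 < 67 := Int.emod_lt_of_pos m (by norm_num)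
  have hne : m % 67 ≠ 0 := fun h => hm (Int.dvd_of_emod_eq_zero h)
  obtain ⟨r, hr⟩ : ∃ r : ℕ, (r : ℤ) = m % 67 := ⟨(m % 67).toNat, Int.toNat_of_nonneg h0⟩
  have hr67 : r < 67 := by omega
  have hr0 : r ≠ 0 := by rintro rfl; exact hne (by simpa using hr.symm)
  have key := pow_eleven_mod67_mem_nat r hr67 hr0
  rw [hr] at key
  have h := (Int.mod_modEq m 67).pow 11
  rw [Int.ModEq] at h
  rwa [h] at key

/-- `29^j mod 67 ∈ {1, 29, 37}` for every `j` (`29³ ≡ 1 (mod 67)`). [folklore] -/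
theorem pow29_mod67_mem (j : ℕ) : ((29 : ℤ) ^ j) % 67 ∈ ([1, 29, 37] : List ℤ) := by
  induction j with
  | zero => decide
  | succ j ih =>
    have step := pow29_step _ ih
    have h := (Int.mod_modEq ((29 : ℤ) ^ j) 67).mul_right 29
    rw [Int.ModEq, ← pow_succ] at h
    rwa [h] at step

/-- A divisor of `29^e` reduces mod 67 into `{1, 29, 37}`. [folklore] -/
theorem dvd_pow29_mod67_mem {D e : ℕ} (hD : D ∣ 29 ^ e) : ((D : ℤ)) % 67 ∈ ([1, 29, 37] : List ℤ) := by
  obtain ⟨j, -, rfl⟩ := (Nat.dvd_prime_pow (by norm_num : Nat.Prime 29)).mp hD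
  push_cast
  exact pow29_mod67_mem j

/-- `(D · m¹¹) mod 67 ∈ μ₆` when `D ∣ 29^e` and `67 ∤ m`. [folklore] -/
theorem coeff_pow_eleven_mod67_mem {D e : ℕ} (hD : D ∣ 29 ^ e) (m : ℤ) (hm : ¬ (67 : ℤ) ∣ m) :
    ((D : ℤ) * m ^ 11) % 67 ∈ mu6Mod67 := by
  have h := mu6Mod67_mul_mem _ (pow29_residues_subset _ (dvd_pow29_mod67_mem hD)) _ (pow_eleven_mod67_mem m hm)
  rwa [← Int.mul_emod] at h

/-! ## The reduction of a datum of the pair `(29, 11)` into the family -/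

/-- **THE REDUCTION (kernel + elementary arithmetic).** If `A·B = 29^e`, `A a¹¹ + B b¹¹ = c³` and `67 ∤ a`, `67 ∤ b`, then the Frey
trace at 67 of the datum `(A, B, 1, 11, a, b, c)` — `a₆₇` of `Y² + 3c·XY + B b¹¹·Y = X³` over `𝔽₆₇` — lies in `T₆₇ = {−16, −10, 5, 8, 11}`:
with `s = c mod 67`, `t = B b¹¹ mod 67 ∈ μ₆`, `u = A a¹¹ mod 67 ∈ μ₆` one has `s³ ≡ t + u`, and `KrausAux67` applies.
[cite: Kraus1998, §1 (reduction of the Frey family at q = kp + 1); BennettVatsalYazdani2004, (2) p.1401 (the curve)] -/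
theorem freyTraceAt67_mem {A B e : ℕ} (hAB : A * B = 29 ^ e) {a b c : ℤ}
    (heq : (A : ℤ) * a ^ 11 + (B : ℤ) * b ^ 11 = c ^ 3) (ha : ¬ (67 : ℤ) ∣ a) (hb : ¬ (67 : ℤ) ∣ b) :
    freyTraceAt 67 ⟨A, B, 1, 11, a, b, c⟩ ∈ krausTraces67 := by
  have hAdvd : A ∣ 29 ^ e := Dvd.intro _ hAB
  have hBdvd : B ∣ 29 ^ e := Dvd.intro_left _ hAB
  -- the residues
  have h0 : 0 ≤ c % 67 := Int.emod_nonneg c (by norm_num)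
  have h1 : c % 67 < 67 := Int.emod_lt_of_pos c (by norm_num)
  obtain ⟨s, hs⟩ : ∃ s : ℕ, (s : ℤ) = c % 67 := ⟨(c % 67).toNat, Int.toNat_of_nonneg h0⟩
  have hs67 : s < 67 := by omega
  set t : ℤ := ((B : ℤ) * b ^ 11) % 67 with ht_def
  set u : ℤ := ((A : ℤ) * a ^ 11) % 67 with hu_def
  have ht : t ∈ mu6Mod67 := coeff_pow_eleven_mod67_mem hBdvd b hb
  have hu : u ∈ mu6Mod67 := coeff_pow_eleven_mod67_mem hAdvd a ha
  -- `s³ ≡ t + u (mod 67)`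
  have hkey : ((s : ℤ) ^ 3) % 67 = (t + u) % 67 := by
    have h := (Int.mod_modEq c 67).pow 3
    rw [Int.ModEq] at h
    rw [hs, h, ← heq, Int.add_emod, ← ht_def, ← hu_def, add_comm u t]
  -- the trace of the datum is the trace of the family member `(3s, t)`
  have htr : freyTraceAt 67 ⟨A, B, 1, 11, a, b, c⟩ = bvyCurveTrace 67 (3 * (s : ℤ)) t := by
    have h3 := (Int.mod_modEq c 67).mul_left 3
    rw [Int.ModEq] at h3
    unfold freyTraceAt
    refine bvyCurveTrace_congr 67 ?_ ?_
    · show (3 * ((1 : ℕ) : ℤ) * c) % ((67 : ℕ) : ℤ) = (3 * (s : ℤ)) % ((67 : ℕ) : ℤ)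
      rw [hs, Nat.cast_one, mul_one, Nat.cast_ofNat, h3]
    · show (((1 : ℕ) : ℤ) ^ 2 * (B : ℤ) * b ^ 11) % ((67 : ℕ) : ℤ) = t % ((67 : ℕ) : ℤ)
      rw [ht_def, Nat.cast_one, one_pow, one_mul, Nat.cast_ofNat, Int.emod_emod_of_dvd _ (dvd_refl (67 : ℤ))]
  rw [htr]
  exact krausAux67 s hs67 t ht u hu hkey

end Summit.Ventures.AbcShadow
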